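import Mathlib.Analysis.SpecialFunctions.Sqrt
import Mathlib.Analysis.SpecialFunctions.Pow.Real
import Mathlib.MeasureTheory.Integral.IntervalIntegral.FundThmCalculus
import Mathlib.Analysis.Calculus.Deriv.Mul
import HarnessLib

/-!
# An integrable clock for Kerr's region II: an explicit bounded primitive dominating
# `1/√((r₊ − r)(r − r₋))`

(family `gr`; namespace `Literature.Geometry.Lorentzian.Kerr`; pure real analysis)

Along a future causal curve of region II of a sub-extremal Kerr black hole the proper-time speed
is at most `−ṙ · √((r₊² + a²)/((r₊ − r)(r − r₋)))` (file `KerrRegionIISpeedBound`). To turn this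
into a bound on the length one needs a bounded primitive of (a majorant of) the rate
`1/√((r₊ − r)(r − r₋))` on `(r₋, r₊)`, whose singularities at both horizons are of square-root
type. Instead of `arcsin((2r − r₊ − r₋)/(r₊ − r₋))` we use the elementary clock

  `K_{m,p}(r) = 2 √(2/(p − m)) · (√(r − m) − √(p − r))`,   `m = r₋ < r < p = r₊`,

which is increasing, bounded (`|K| ≤ 2 √(2/(p − m)) √(p − m)`), and whose derivative
`√(2/(p − m)) (1/√(r − m) + 1/√(p − r))` dominates `1/√((p − r)(r − m))` because
`√(p − r) + √(r − m) ≥ √(p − m)`: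

* `Kerr.hasDerivAt_regionIIClock`, `Kerr.regionIIClock_deriv_pos`;
* `Kerr.inv_sqrt_mul_le_regionIIClockDeriv` — `1/√((p − r)(r − m)) ≤ K'(r)`;
* `Kerr.abs_regionIIClock_le`, `Kerr.regionIIClock_sub_le` — the oscillation of `K` over
  `(m, p)` is at most `regionIIClockBound m p = 4 √(2/(p − m)) √(p − m)` (`= 4√2`).

## References

* B. O'Neill, *The Geometry of Kerr Black Holes*, A K Peters 1995, §2.4–2.5 (region II,
  `Δ = (r − r₊)(r − r₋)`). Key `ONeill1995`.
-/

noncomputable section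

open Set

namespace Literature.Geometry.Lorentzian.Kerr

/-- **The region-II clock** `K_{m,p}(r) = 2√(2/(p − m)) (√(r − m) − √(p − r))` on `(m, p)`
(for Kerr: `m = r₋`, `p = r₊`). O'Neill 1995, §2.5 (any bounded primitive of the rate
`1/√(−Δ)` serves). [cite: ONeill1995, §2.5] -/
def regionIIClock (m p r : ℝ) : ℝ :=
  2 * Real.sqrt (2 / (p - m)) * (Real.sqrt (r - m) - Real.sqrt (p - r))

/-- The rate of the region-II clock, `K'(r) = √(2/(p − m)) (1/√(r − m) + 1/√(p − r))`.
[cite: ONeill1995, §2.5] -/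
def regionIIClockDeriv (m p r : ℝ) : ℝ :=
  Real.sqrt (2 / (p - m)) * (1 / Real.sqrt (r - m) + 1 / Real.sqrt (p - r))

/-- The oscillation bound of the region-II clock, `4 √(2/(p − m)) √(p − m)` (`= 4√2` for
`m < p`). [cite: ONeill1995, §2.5] -/
def regionIIClockBound (m p : ℝ) : ℝ :=
  4 * Real.sqrt (2 / (p - m)) * Real.sqrt (p - m)

/-- `0 ≤ regionIIClockBound m p`. [folklore] -/
theorem regionIIClockBound_nonneg (m p : ℝ) : 0 ≤ regionIIClockBound m p := by
  unfold regionIIClockBound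
  positivity

/-- **The clock is differentiable on `(m, p)`** with derivative `regionIIClockDeriv`
(`(√(r − m))' = 1/(2√(r − m))`, `(√(p − r))' = −1/(2√(p − r))`). [folklore] -/
theorem hasDerivAt_regionIIClock {m p r : ℝ} (h₁ : m < r) (h₂ : r < p) :
    HasDerivAt (regionIIClock m p) (regionIIClockDeriv m p r) r := by
  have hA : HasDerivAt (fun s ↦ Real.sqrt (s - m)) (1 / (2 * Real.sqrt (r - m))) r :=
    HasDerivAt.sqrt (HasDerivAt.sub_const m (hasDerivAt_id r)) (sub_pos.2 h₁).ne'
  have hB : HasDerivAt (fun s ↦ Real.sqrt (p - s)) (-1 / (2 * Real.sqrt (p - r))) r :=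
    HasDerivAt.sqrt (HasDerivAt.const_sub p (hasDerivAt_id r)) (sub_pos.2 h₂).ne'
  have h := HasDerivAt.const_mul (2 * Real.sqrt (2 / (p - m))) (HasDerivAt.sub hA hB)
  refine h.congr_deriv ?_
  unfold regionIIClockDeriv
  ring

/-- The clock rate is positive on `(m, p)`. [folklore] -/
theorem regionIIClockDeriv_pos {m p r : ℝ} (h₁ : m < r) (h₂ : r < p) :
    0 < regionIIClockDeriv m p r := by
  unfold regionIIClockDeriv
  have hpm : 0 < p - m := by linarith
  have h1 : 0 < Real.sqrt (r - m) := Real.sqrt_pos.2 (by linarith)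
  have h2 : 0 < Real.sqrt (p - r) := Real.sqrt_pos.2 (by linarith)
  positivity

/-- **The clock rate dominates `1/√((p − r)(r − m))`** on `(m, p)`: with `A = p − r`, `B = r − m`,
`1/√(AB) ≤ √(2/(A + B)) (1/√A + 1/√B)` because `√(2/(A + B)) (√A + √B) ≥ √2 ≥ 1`
(`(√A + √B)² ≥ A + B`). [folklore] -/
theorem inv_sqrt_mul_le_regionIIClockDeriv {m p r : ℝ} (h₁ : m < r) (h₂ : r < p) :
    1 / Real.sqrt ((p - r) * (r - m)) ≤ regionIIClockDeriv m p r := by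
  unfold regionIIClockDeriv
  set A := p - r with hA
  set B := r - m with hB
  have hA0 : 0 < A := by rw [hA]; linarith
  have hB0 : 0 < B := by rw [hB]; linarith
  have hL : p - m = A + B := by rw [hA, hB]; ring
  rw [hL]
  have hsA : 0 < Real.sqrt A := Real.sqrt_pos.2 hA0
  have hsB : 0 < Real.sqrt B := Real.sqrt_pos.2 hB0
  have hsAB : Real.sqrt (A * B) = Real.sqrt A * Real.sqrt B := Real.sqrt_mul hA0.le B
  -- `X = √(2/(A+B)) (√A + √B) ≥ 1`
  set X := Real.sqrt (2 / (A + B)) * (Real.sqrt A + Real.sqrt B) with hX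
  have hX0 : 0 ≤ X := by rw [hX]; positivity
  have hX2 : 1 ≤ X ^ 2 := by
    have h2 : Real.sqrt (2 / (A + B)) ^ 2 = 2 / (A + B) := Real.sq_sqrt (by positivity)
    have hAA : Real.sqrt A ^ 2 = A := Real.sq_sqrt hA0.le
    have hBB : Real.sqrt B ^ 2 = B := Real.sq_sqrt hB0.le
    have hsum : A + B ≤ (Real.sqrt A + Real.sqrt B) ^ 2 := by
      nlinarith [mul_pos hsA hsB]
    rw [hX, mul_pow, h2]
    rw [div_mul_eq_mul_div, le_div_iff₀ (by positivity)]
    nlinarith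
  have hX1 : 1 ≤ X := by nlinarith
  -- divide by `√A √B`
  have key : 1 / (Real.sqrt A * Real.sqrt B) ≤ X / (Real.sqrt A * Real.sqrt B) :=
    div_le_div_of_nonneg_right hX1 (by positivity)
  rw [hsAB]
  calc 1 / (Real.sqrt A * Real.sqrt B) ≤ X / (Real.sqrt A * Real.sqrt B) := key
    _ = Real.sqrt (2 / (A + B)) * ((Real.sqrt A + Real.sqrt B) / (Real.sqrt A * Real.sqrt B)) := by
        rw [hX, mul_div_assoc]
    _ = Real.sqrt (2 / (A + B)) * (1 / Real.sqrt B + 1 / Real.sqrt A) := by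
        rw [div_add_div _ _ hsB.ne' hsA.ne']
        ring

/-- **The clock is bounded**: `|K(r)| ≤ 2√(2/(p − m)) √(p − m)` for `m ≤ r ≤ p`
(`√(r − m), √(p − r) ≤ √(p − m)`). [folklore] -/
theorem abs_regionIIClock_le {m p r : ℝ} (h₁ : m ≤ r) (h₂ : r ≤ p) :
    |regionIIClock m p r| ≤ 2 * Real.sqrt (2 / (p - m)) * Real.sqrt (p - m) := by
  unfold regionIIClock
  have hk : 0 ≤ 2 * Real.sqrt (2 / (p - m)) := by positivity
  rw [abs_mul, abs_of_nonneg hk]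
  refine mul_le_mul_of_nonneg_left ?_ hk
  have h1 : Real.sqrt (r - m) ≤ Real.sqrt (p - m) := Real.sqrt_le_sqrt (by linarith)
  have h2 : Real.sqrt (p - r) ≤ Real.sqrt (p - m) := Real.sqrt_le_sqrt (by linarith)
  have h3 : 0 ≤ Real.sqrt (r - m) := Real.sqrt_nonneg _
  have h4 : 0 ≤ Real.sqrt (p - r) := Real.sqrt_nonneg _
  rw [abs_le]
  constructor <;> linarith

/-- **The oscillation of the clock over `[m, p]` is at most `regionIIClockBound m p`.**
[folklore] -/
theorem regionIIClock_sub_le {m p r r' : ℝ} (h₁ : m ≤ r) (h₂ : r ≤ p) (h₁' : m ≤ r') (h₂' : r' ≤ p) :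
    regionIIClock m p r - regionIIClock m p r' ≤ regionIIClockBound m p := by
  have h := abs_regionIIClock_le h₁ h₂
  have h' := abs_regionIIClock_le h₁' h₂'
  rw [abs_le] at h h'
  unfold regionIIClockBound
  linarith

end Literature.Geometry.Lorentzian.Kerr

end
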